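import Literature.Probability.Percolation.TwoGhostInequalityProofs
import Literature.Probability.Percolation.UniquenessInfiniteCluster
import HarnessLib

/-!
# Crux `PercRayRenewal.JumpLineAvoidanceDecay` (stmt-CriticalPhenomena-4626) — structural stub c9-S1
`real_notReachable_touchCard_le_twoGhost` (Hutchcroft's insertion-tolerance surgery on `ℤ^d`)

Helper file of the line `registered` of the crux `JumpLineAvoidanceDecay`; lands with
`--supports stmt-CriticalPhenomena-4626` (structural stub c9-S1 of `Lines/birth.lean`, §4).

## Statement

For `d ≥ 1`, `p ∈ (0,1)`, `n ≥ 1`, `k ≥ 0` and `v = k e₀`: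
`P_p(0 ↮ v, |E(K_0)| ≥ n, |E(K_v)| ≥ n) ≤ p^{-k} (1-p)^{-1} · 66 · 2d · √((1-p)/(p n))`,
where `E(K)` is the set of lattice edges touching the cluster `K`.

## Proof (Hutchcroft, Ann. Probab. 48 (2020), arXiv:1808.08940, §4, proof of Thm 1.3, eq. (4.2))

Let `x_i = i e₀`, `γ_i = {x_i, x_{i+1}}` (`0 ≤ i < k`) and `F_i = {γ_0, …, γ_{i-1}}`. On the event
`A` of the statement let `m` be the least index with `0 ↔ v` in `ω ∪ F_m` (`m ≤ k` since `F_k` is a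
path from `0` to `v`; `m ≥ 1` since `ω ∉ {0 ↔ v}`), and put `ω' = ω ∪ F_{m-1}`. Adding the single
edge `γ_{m-1}` to `ω'` joins `0` to `v`, and `C(a) ∪ C(b)` is unchanged by opening `{a, b}`
(`TwoGhost.union_openCluster_insert_eq_self`), so in `ω'`: `0 ↔ x_{m-1}`, `x_m ↔ v`, `x_{m-1} ↮ x_m`,
`γ_{m-1}` is closed, and the clusters of `x_{m-1}`, `x_m` contain `K_0(ω)`, `K_v(ω)` and hence touch
at least `n` edges: `ω' ∈ S'_{m-1}`, the two-cluster event at the edge `γ_{m-1}` WITHOUT finiteness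
clause. Thus `A ⊆ ⋃_{i<k} {ω | ω ∪ F_i ∈ S'_i}` (`TwoGhostSurgery.exists_lt_openEdges_mem`, written
for an arbitrary path `x_0, x_1, …`). Insertion tolerance
(`bondPercolation_pow_mul_real_preimage_openEdges_le`) gives `p^i P(ω ∪ F_i ∈ S'_i) ≤ P(S'_i)`;
a.s. uniqueness of the infinite cluster (`Grimmett1999_numInfiniteClusters_le_one_holds`) shows that
`S'_i` is a.s. contained in Hutchcroft's event `𝒮_{γ_i,n}` (one of the two clusters is finite), whose
probability is at most `Q = 66 · 2d · √((1-p)/(pn))` (`Hutchcroft2020_twoGhost_corollary_holds`).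
Summing, `P(A) ≤ Q Σ_{i<k} p^{-i} ≤ Q p^{-k}/(1-p)`.

## References

* T. Hutchcroft, *Locality of the critical probability for transitive graphs of exponential
  growth*, Ann. Probab. 48 (2020) 1352–1371, arXiv:1808.08940, §4 eq. (4.2) and Cor. 1.7
  [Hutchcroft2020Locality].
* G. Grimmett, *Percolation*, 2nd ed., Springer 1999, Thm. (8.1) (uniqueness) [GrimmettPercolation1999].
-/

noncomputable section

namespace Summit.CriticalPhenomena.PercolationContinuityZ3.Theorems

open MeasureTheory Literature.Probability.Percolation Literature.Probability.LatticeModels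

namespace TwoGhostSurgery

variable {d : ℕ}

/-! ### Opening the first edges of a sequence `γ_0, γ_1, …` -/

/-- `ω ∪ {γ_j | j < 0} = ω`. [folklore] -/
theorem openEdges_image_range_zero {V : Type*} [DecidableEq V] (γ : ℕ → Sym2 V)
    (ω : BondConfig V) : openEdges (↑((Finset.range 0).image γ)) ω = ω := by
  rw [Finset.range_zero, Finset.image_empty, Finset.coe_empty]
  exact Set.union_empty ω

/-- `ω ∪ {γ_j | j < i+1} = (ω ∪ {γ_j | j < i}) ∪ {γ_i}`. [folklore] -/
theorem openEdges_image_range_succ {V : Type*} [DecidableEq V] (γ : ℕ → Sym2 V) (i : ℕ)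
    (ω : BondConfig V) :
    openEdges (↑((Finset.range (i + 1)).image γ)) ω =
      insert (γ i) (openEdges (↑((Finset.range i).image γ)) ω) := by
  have h : (↑((Finset.range (i + 1)).image γ) : Set (Sym2 V)) =
      insert (γ i) ↑((Finset.range i).image γ) := by
    rw [Finset.range_add_one, Finset.image_insert, Finset.coe_insert]
  show ω ∪ _ = insert _ (ω ∪ _)
  rw [h, Set.union_insert]

/-- If the edges `{x_j, x_{j+1}}`, `j < i`, of a sequence of pairwise-successively distinct sites are
open in `η`, then `x_0 ↔ x_i` in `η`. [folklore] -/
theorem reachable_of_forall_mem {V : Type*} (x : ℕ → V) (hx : ∀ i, x i ≠ x (i + 1))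
    {η : BondConfig V} {i : ℕ} (h : ∀ j < i, s(x j, x (j + 1)) ∈ η) :
    (openGraph η).Reachable (x 0) (x i) := by
  induction i with
  | zero => rfl
  | succ i ih =>
    have hadj : (openGraph η).Adj (x i) (x (i + 1)) :=
      (openGraph_adj η _ _).2 ⟨h i (Nat.lt_succ_self i), hx i⟩
    exact (ih fun j hj => h j (Nat.lt_succ_of_lt hj)).trans hadj.reachable

/-! ### The surgery (Hutchcroft 2020, §4): `A ⊆ ⋃_{i<k} {ω | ω ∪ F_i ∈ S'_i}` -/

/-- **Hutchcroft's surgery along a path `x_0, x_1, …, x_k`** (`γ_i = {x_i, x_{i+1}}`,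
`F_i = {γ_0, …, γ_{i-1}}`). If `x_0 ↮ x_k` in `ω` and both `C(x_0)`, `C(x_k)` touch at least `n`
edges of `ℤ^d`, then for the least `m` with `x_0 ↔ x_k` in `ω ∪ F_m` one has `1 ≤ m ≤ k` and
`ω' = ω ∪ F_{m-1}` lies in `S'_{m-1}`: `γ_{m-1} ∉ ω'`, `x_{m-1} ↮ x_m` in `ω'`, and both
`C_{ω'}(x_{m-1}) = C_{ω'}(x_0) ⊇ C_ω(x_0)` and `C_{ω'}(x_m) = C_{ω'}(x_k) ⊇ C_ω(x_k)` touch at least `n`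
edges. Key step: `C(a) ∪ C(b)` is unchanged by opening `{a, b}`
(`TwoGhost.union_openCluster_insert_eq_self`). [cite: Hutchcroft2020Locality, §4 eq. (4.2)] -/
theorem exists_lt_openEdges_mem (x : ℕ → Site d) (hx : ∀ i, x i ≠ x (i + 1)) {n k : ℕ}
    {ω : BondConfig (Site d)} (hnr : ¬ (openGraph ω).Reachable (x 0) (x k))
    (h0 : (n : ℕ∞) ≤ {e ∈ (zdGraph d).edgeSet | ∃ w ∈ e, w ∈ openCluster ω (x 0)}.encard)
    (hk : (n : ℕ∞) ≤ {e ∈ (zdGraph d).edgeSet | ∃ w ∈ e, w ∈ openCluster ω (x k)}.encard) :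
    ∃ i < k, openEdges (↑((Finset.range i).image fun j => s(x j, x (j + 1)))) ω ∈
      {ω | s(x i, x (i + 1)) ∉ ω ∧ ¬ (openGraph ω).Reachable (x i) (x (i + 1)) ∧
           (n : ℕ∞) ≤ {e ∈ (zdGraph d).edgeSet | ∃ w ∈ e, w ∈ openCluster ω (x i)}.encard ∧
           (n : ℕ∞) ≤ {e ∈ (zdGraph d).edgeSet | ∃ w ∈ e, w ∈ openCluster ω (x (i + 1))}.encard} := by
  set γ : ℕ → Sym2 (Site d) := fun j => s(x j, x (j + 1)) with hγ
  -- `F_k` is an open path from `x_0` to `x_k` in `ω ∪ F_k`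
  have hPk : (openGraph (openEdges (↑((Finset.range k).image γ)) ω)).Reachable (x 0) (x k) :=
    reachable_of_forall_mem x hx fun j hj => (mem_openEdges _ _ _).2
      (Or.inr (Finset.mem_coe.2 (Finset.mem_image_of_mem γ (Finset.mem_range.2 hj))))
  -- the least number `m` of opened path edges joining `x_0` to `x_k`
  set T : Set ℕ := {i | (openGraph (openEdges (↑((Finset.range i).image γ)) ω)).Reachable (x 0) (x k)}
    with hT
  have hkT : k ∈ T := hPk
  obtain ⟨m, hPm, hmin⟩ : ∃ m, m ∈ T ∧ ∀ j < m, j ∉ T :=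
    ⟨sInf T, Nat.sInf_mem ⟨k, hkT⟩, fun j hj => Nat.notMem_of_lt_sInf hj⟩
  have hmk : m ≤ k := not_lt.1 fun h => hmin k h hkT
  obtain ⟨i, rfl⟩ : ∃ i, m = i + 1 := by
    refine Nat.exists_eq_succ_of_ne_zero ?_
    rintro rfl
    have h0T : (openGraph (openEdges (↑((Finset.range 0).image γ)) ω)).Reachable (x 0) (x k) := hPm
    rw [openEdges_image_range_zero] at h0T
    exact hnr h0T
  refine ⟨i, by omega, ?_⟩
  set ω' := openEdges (↑((Finset.range i).image γ)) ω with hω'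
  -- (a) `x_0 ↔ x_i` in `ω'`; (b) `x_0 ↮ x_k` in `ω'`; (c) `x_{i+1} ↔ x_k` in `ω'`
  have ha : (openGraph ω').Reachable (x 0) (x i) :=
    reachable_of_forall_mem x hx fun j hj => (mem_openEdges _ _ _).2
      (Or.inr (Finset.mem_coe.2 (Finset.mem_image_of_mem γ (Finset.mem_range.2 hj))))
  have hb : ¬ (openGraph ω').Reachable (x 0) (x k) := hmin i (Nat.lt_succ_self i)
  have hc : (openGraph ω').Reachable (x (i + 1)) (x k) := by
    have hPm' : (openGraph (openEdges (↑((Finset.range (i + 1)).image γ)) ω)).Reachable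
        (x 0) (x k) := hPm
    rw [openEdges_image_range_succ] at hPm'
    have h1 : x k ∈ openCluster (insert (γ i) ω') (x i) :=
      (ha.mono (openGraph_mono (Set.subset_insert _ _))).symm.trans hPm'
    have h2 : x k ∈ openCluster ω' (x i) ∪ openCluster ω' (x (i + 1)) := by
      rw [← TwoGhost.union_openCluster_insert_eq_self ω' (x i) (x (i + 1))]
      exact Or.inl h1
    rcases h2 with h2 | h2
    · exact absurd (ha.trans h2) hb
    · exact h2
  have hne : ¬ (openGraph ω').Reachable (x i) (x (i + 1)) :=
    fun h => hb (ha.trans (h.trans hc))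
  refine ⟨fun hmem => hne ((openGraph_adj ω' _ _).2 ⟨hmem, hx i⟩).reachable, hne, ?_, ?_⟩
  · -- `C_{ω'}(x_i) = C_{ω'}(x_0) ⊇ C_ω(x_0)`
    rw [TwoGhost.openCluster_eq_of_mem ha]
    exact h0.trans (Set.encard_le_encard
      (TwoGhost.touch_mono (openCluster_mono (subset_openEdges _ _) _)))
  · -- `C_{ω'}(x_{i+1}) = C_{ω'}(x_k) ⊇ C_ω(x_k)`
    rw [← TwoGhost.openCluster_eq_of_mem hc]
    exact hk.trans (Set.encard_le_encard
      (TwoGhost.touch_mono (openCluster_mono (subset_openEdges _ _) _)))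

/-! ### The price of the corridor and the two-ghost bound -/

/-- **`P(ω ∪ F_i ∈ S'_i) ≤ p^{-i} · 66 · 2d · √((1-p)/(pn))`** for a path `x_0 ∼ x_1 ∼ ⋯` of lattice
edges. The event `S'_i` (edge `{x_i, x_{i+1}}` closed, `x_i ↮ x_{i+1}`, both clusters touching `≥ n`
edges) is measurable; almost surely there is at most one infinite cluster
(`Grimmett1999_numInfiniteClusters_le_one_holds`), so a.s. on `S'_i` one of the two distinct clusters
is finite and the two-ghost inequality (`Hutchcroft2020_twoGhost_corollary_holds`) gives
`P(S'_i) ≤ 66 · 2d · √((1-p)/(pn))`; insertion tolerance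
(`bondPercolation_pow_mul_real_preimage_openEdges_le`, `|F_i| ≤ i`) gives
`p^i P(ω ∪ F_i ∈ S'_i) ≤ P(S'_i)`. [cite: Hutchcroft2020Locality, §4 eq. (4.2) and Cor. 1.7] -/
theorem real_preimage_openEdges_le (hd : 1 ≤ d) (p : unitInterval) (hp0 : 0 < (p : ℝ)) {n : ℕ}
    (hn : 1 ≤ n) (x : ℕ → Site d) (hadj : ∀ i, (zdGraph d).Adj (x i) (x (i + 1))) (i : ℕ) :
    (bondPercolation (zdGraph d) p).real
        (openEdges (↑((Finset.range i).image fun j => s(x j, x (j + 1)))) ⁻¹'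
          {ω | s(x i, x (i + 1)) ∉ ω ∧ ¬ (openGraph ω).Reachable (x i) (x (i + 1)) ∧
               (n : ℕ∞) ≤ {e ∈ (zdGraph d).edgeSet | ∃ w ∈ e, w ∈ openCluster ω (x i)}.encard ∧
               (n : ℕ∞) ≤ {e ∈ (zdGraph d).edgeSet |
                              ∃ w ∈ e, w ∈ openCluster ω (x (i + 1))}.encard}) ≤
      ((p : ℝ)⁻¹) ^ i * (66 * (2 * (d : ℝ)) * Real.sqrt ((1 - (p : ℝ)) / ((p : ℝ) * n))) := by
  set S : Set (BondConfig (Site d)) :=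
    {ω | s(x i, x (i + 1)) ∉ ω ∧ ¬ (openGraph ω).Reachable (x i) (x (i + 1)) ∧
         (n : ℕ∞) ≤ {e ∈ (zdGraph d).edgeSet | ∃ w ∈ e, w ∈ openCluster ω (x i)}.encard ∧
         (n : ℕ∞) ≤ {e ∈ (zdGraph d).edgeSet | ∃ w ∈ e, w ∈ openCluster ω (x (i + 1))}.encard}
    with hS
  set F : Finset (Sym2 (Site d)) := (Finset.range i).image fun j => s(x j, x (j + 1)) with hF
  -- measurability of `S'_i`
  have hSeq : S = {ω | s(x i, x (i + 1)) ∉ ω} ∩ ({ω | x (i + 1) ∈ openCluster ω (x i)}ᶜ ∩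
      ({ω | (n : ℕ∞) ≤ (TwoGhost.touch (zdGraph d) (openCluster ω (x i))).encard} ∩
        {ω | (n : ℕ∞) ≤ (TwoGhost.touch (zdGraph d) (openCluster ω (x (i + 1)))).encard})) :=
    Set.ext fun _ => Iff.rfl
  have hSm : MeasurableSet S := by
    rw [hSeq]
    exact (measurableSet_notMem _).inter ((TwoGhost.measurableSet_mem_openCluster _ _).compl.inter
      ((TwoGhost.measurableSet_le_encard_touch hd n _).inter
        (TwoGhost.measurableSet_le_encard_touch hd n _)))
  -- `P(S'_i) ≤ Q` by a.s. uniqueness and the two-ghost inequality at the edge `{x_i, x_{i+1}}`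
  have hSle : (bondPercolation (zdGraph d) p).real S ≤
      66 * (2 * (d : ℝ)) * Real.sqrt ((1 - (p : ℝ)) / ((p : ℝ) * n)) := by
    refine le_trans ?_
      (Hutchcroft2020_twoGhost_corollary_holds d hd p hp0 n hn (x i) (x (i + 1)) (hadj i))
    refine ENNReal.toReal_mono (measure_ne_top _ _) (measure_mono_ae ?_)
    filter_upwards [Grimmett1999_numInfiniteClusters_le_one_holds d p] with ω hN
    rintro ⟨h1, h2, h3, h4⟩
    refine ⟨h1, h2, h3, h4, ?_⟩
    by_contra h
    obtain ⟨hxi, hyi⟩ := not_or.1 h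
    exact h2 ((numInfiniteClusters_le_one_iff ω).1 hN _ _ hxi hyi)
  -- insertion tolerance: `p^{|F_i|} P(ω ∪ F_i ∈ S'_i) ≤ P(S'_i)`, and `|F_i| ≤ i`
  have hFE : (↑F : Set (Sym2 (Site d))) ⊆ (zdGraph d).edgeSet := by
    intro e he
    rw [Finset.mem_coe, hF, Finset.mem_image] at he
    obtain ⟨j, -, rfl⟩ := he
    exact (SimpleGraph.mem_edgeSet _).2 (hadj j)
  have hins := bondPercolation_pow_mul_real_preimage_openEdges_le (zdGraph d) p F hFE hSm
  have hpow : (p : ℝ) ^ i ≤ (p : ℝ) ^ F.card :=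
    pow_le_pow_of_le_one hp0.le p.2.2 (Finset.card_image_le.trans (Finset.card_range i).le)
  have h1 : (p : ℝ) ^ i * (bondPercolation (zdGraph d) p).real (openEdges ↑F ⁻¹' S) ≤
      66 * (2 * (d : ℝ)) * Real.sqrt ((1 - (p : ℝ)) / ((p : ℝ) * n)) :=
    ((mul_le_mul_of_nonneg_right hpow measureReal_nonneg).trans hins).trans hSle
  calc (bondPercolation (zdGraph d) p).real (openEdges ↑F ⁻¹' S)
      = ((p : ℝ)⁻¹) ^ i * ((p : ℝ) ^ i * (bondPercolation (zdGraph d) p).real (openEdges ↑F ⁻¹' S)) := by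
        rw [← mul_assoc, ← mul_pow, inv_mul_cancel₀ hp0.ne', one_pow, one_mul]
    _ ≤ ((p : ℝ)⁻¹) ^ i * (66 * (2 * (d : ℝ)) * Real.sqrt ((1 - (p : ℝ)) / ((p : ℝ) * n))) :=
        mul_le_mul_of_nonneg_left h1 (pow_nonneg (inv_nonneg.2 hp0.le) i)

/-! ### The geometric sum `Σ_{i<k} p^{-i} ≤ p^{-k}/(1-p)` -/

/-- `Σ_{i<k} p^{-i} = p (p^{-k} - 1)/(1 - p) ≤ p^{-k}/(1-p)` for `0 < p < 1`. [folklore] -/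
theorem geom_sum_inv_le {p : ℝ} (hp0 : 0 < p) (hp1 : p < 1) (k : ℕ) :
    ∑ i ∈ Finset.range k, (p⁻¹) ^ i ≤ (p⁻¹) ^ k / (1 - p) := by
  have h1p : 0 < 1 - p := sub_pos.2 hp1
  rw [le_div_iff₀ h1p]
  have hgeom := geom_sum_mul (p⁻¹) k
  have hr : (1 - p) = p * (p⁻¹ - 1) := by
    rw [mul_sub, mul_inv_cancel₀ hp0.ne', mul_one]
  have hrk : 0 ≤ (p⁻¹) ^ k := pow_nonneg (inv_nonneg.2 hp0.le) k
  calc (∑ i ∈ Finset.range k, (p⁻¹) ^ i) * (1 - p)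
      = p * ((∑ i ∈ Finset.range k, (p⁻¹) ^ i) * (p⁻¹ - 1)) := by rw [hr]; ring
    _ = p * ((p⁻¹) ^ k - 1) := by rw [hgeom]
    _ ≤ (p⁻¹) ^ k := by
        have : 0 ≤ (p⁻¹) ^ k * (1 - p) := mul_nonneg hrk h1p.le
        nlinarith

end TwoGhostSurgery

open TwoGhostSurgery in
/-- **Structural stub (c9-S1) — Hutchcroft's surgery on `ℤ^d` (arXiv:1808.08940 §4, eq. (4.2)), every
`p ∈ (0,1)`.** For `d ≥ 1`, `n ≥ 1`, `k ≥ 0`: the probability that `0` and `k e₀` lie in distinct open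
clusters each touching at least `n` lattice edges is at most
`p^{-k} (1-p)^{-1} · 66 · 2d · √((1-p)/(p n))`. Proof: open the axis edges `γ_i = ⟨i e₀, (i+1) e₀⟩`
one by one; the first `m` for which `0 ↔ k e₀` in `ω ∪ {γ_0,…,γ_{m-1}}` exhibits, in
`ω' = ω ∪ {γ_0,…,γ_{m-2}}`, the closed edge `γ_{m-1}` with endpoints in distinct clusters touching `≥ n`
edges (`TwoGhostSurgery.exists_lt_openEdges_mem`), one of them finite a.s. by uniqueness
(`Grimmett1999_numInfiniteClusters_le_one_holds`); the map `ω ↦ ω ∪ F` costs a factor `p^{-|F|}`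
(`bondPercolation_pow_mul_real_preimage_openEdges_le`), the two-ghost inequality
(`Hutchcroft2020_twoGhost_corollary_holds`) bounds each term (`TwoGhostSurgery.real_preimage_openEdges_le`),
and `Σ_{i<k} p^{-i} ≤ p^{-k}/(1-p)`. [cite: Hutchcroft2020Locality, §4 eq. (4.2) and Cor. 1.7] -/
theorem real_notReachable_touchCard_le_twoGhost {d : ℕ} (hd : 1 ≤ d) (p : unitInterval)
    (hp0 : 0 < (p : ℝ)) (hp1 : (p : ℝ) < 1) {n : ℕ} (hn : 1 ≤ n) (k : ℕ) :
    (bondPercolation (zdGraph d) p).real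
        {ω | ¬ (openGraph ω).Reachable (0 : Site d) (Pi.single ⟨0, hd⟩ (k : ℤ)) ∧
             (n : ℕ∞) ≤ {e ∈ (zdGraph d).edgeSet | ∃ w ∈ e, w ∈ openCluster ω (0 : Site d)}.encard ∧
             (n : ℕ∞) ≤ {e ∈ (zdGraph d).edgeSet |
                            ∃ w ∈ e, w ∈ openCluster ω (Pi.single ⟨0, hd⟩ (k : ℤ))}.encard}
      ≤ ((p : ℝ)⁻¹) ^ k / (1 - (p : ℝ)) *
          (66 * (2 * (d : ℝ)) * Real.sqrt ((1 - (p : ℝ)) / ((p : ℝ) * n))) := by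
  set Q : ℝ := 66 * (2 * (d : ℝ)) * Real.sqrt ((1 - (p : ℝ)) / ((p : ℝ) * n)) with hQ
  have hQ0 : 0 ≤ Q := by positivity
  -- the axis sites `x_i = i e₀`
  set x : ℕ → Site d := fun i => Pi.single (⟨0, hd⟩ : Fin d) (i : ℤ) with hx
  have hx0 : x 0 = 0 := by simp [hx]
  have hsucc : ∀ i, x (i + 1) = x i + Pi.single (⟨0, hd⟩ : Fin d) 1 := by
    intro i
    simp only [hx]
    push_cast
    rw [Pi.single_add]
  have hadj : ∀ i, (zdGraph d).Adj (x i) (x (i + 1)) := fun i =>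
    (zdGraph_adj_iff _ _).2 ⟨⟨0, hd⟩, Or.inl (hsucc i)⟩
  have hsub : {ω | ¬ (openGraph ω).Reachable (0 : Site d) (Pi.single ⟨0, hd⟩ (k : ℤ)) ∧
      (n : ℕ∞) ≤ {e ∈ (zdGraph d).edgeSet | ∃ w ∈ e, w ∈ openCluster ω (0 : Site d)}.encard ∧
      (n : ℕ∞) ≤ {e ∈ (zdGraph d).edgeSet |
        ∃ w ∈ e, w ∈ openCluster ω (Pi.single ⟨0, hd⟩ (k : ℤ))}.encard} ⊆
      ⋃ i ∈ Finset.range k, openEdges (↑((Finset.range i).image fun j => s(x j, x (j + 1)))) ⁻¹'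
        {ω | s(x i, x (i + 1)) ∉ ω ∧ ¬ (openGraph ω).Reachable (x i) (x (i + 1)) ∧
             (n : ℕ∞) ≤ {e ∈ (zdGraph d).edgeSet | ∃ w ∈ e, w ∈ openCluster ω (x i)}.encard ∧
             (n : ℕ∞) ≤ {e ∈ (zdGraph d).edgeSet |
                            ∃ w ∈ e, w ∈ openCluster ω (x (i + 1))}.encard} := by
    rintro ω ⟨hnr, h0, hk⟩
    have hnr' : ¬ (openGraph ω).Reachable (x 0) (x k) := by rw [hx0]; exact hnr
    have h0' : (n : ℕ∞) ≤ {e ∈ (zdGraph d).edgeSet | ∃ w ∈ e, w ∈ openCluster ω (x 0)}.encard := by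
      rw [hx0]; exact h0
    obtain ⟨i, hi, hmem⟩ := exists_lt_openEdges_mem x (fun i => (hadj i).ne) hnr' h0' hk
    exact Set.mem_iUnion₂.2 ⟨i, Finset.mem_range.2 hi, hmem⟩
  calc (bondPercolation (zdGraph d) p).real _
      ≤ (bondPercolation (zdGraph d) p).real (⋃ i ∈ Finset.range k,
          openEdges (↑((Finset.range i).image fun j => s(x j, x (j + 1)))) ⁻¹'
            {ω | s(x i, x (i + 1)) ∉ ω ∧ ¬ (openGraph ω).Reachable (x i) (x (i + 1)) ∧
                 (n : ℕ∞) ≤ {e ∈ (zdGraph d).edgeSet | ∃ w ∈ e, w ∈ openCluster ω (x i)}.encard ∧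
                 (n : ℕ∞) ≤ {e ∈ (zdGraph d).edgeSet |
                                ∃ w ∈ e, w ∈ openCluster ω (x (i + 1))}.encard}) :=
        measureReal_mono hsub (measure_ne_top _ _)
    _ ≤ ∑ i ∈ Finset.range k, (bondPercolation (zdGraph d) p).real
          (openEdges (↑((Finset.range i).image fun j => s(x j, x (j + 1)))) ⁻¹'
            {ω | s(x i, x (i + 1)) ∉ ω ∧ ¬ (openGraph ω).Reachable (x i) (x (i + 1)) ∧
                 (n : ℕ∞) ≤ {e ∈ (zdGraph d).edgeSet | ∃ w ∈ e, w ∈ openCluster ω (x i)}.encard ∧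
                 (n : ℕ∞) ≤ {e ∈ (zdGraph d).edgeSet |
                                ∃ w ∈ e, w ∈ openCluster ω (x (i + 1))}.encard}) :=
        measureReal_biUnion_finset_le _ _
    _ ≤ ∑ i ∈ Finset.range k, ((p : ℝ)⁻¹) ^ i * Q :=
        Finset.sum_le_sum fun i _ => real_preimage_openEdges_le hd p hp0 hn x hadj i
    _ = (∑ i ∈ Finset.range k, ((p : ℝ)⁻¹) ^ i) * Q := by rw [Finset.sum_mul]
    _ ≤ ((p : ℝ)⁻¹) ^ k / (1 - (p : ℝ)) * Q :=
        mul_le_mul_of_nonneg_right (geom_sum_inv_le hp0 hp1 k) hQ0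

end Summit.CriticalPhenomena.PercolationContinuityZ3.Theorems

end
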